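import Summits.FinalStateConjecture.FinalStateConjecture.Theses.EIHFluxBalance
import Summits.FinalStateConjecture.FinalStateConjecture.Theses.SwallowTheDatum
import Summits.FinalStateConjecture.FinalStateConjecture.Theorems.SwallowTheDatumKerrShieldedSettlesStubCollarCauchy
import Summits.FinalStateConjecture.FinalStateConjecture.Theorems.SwallowTheDatumKerrShieldedSettlesStubCollarEmbedsMGHD
import Summits.FinalStateConjecture.FinalStateConjecture.Theorems.SwallowTheDatumKerrShieldedSettlesStubKerrLeafSojourn
import Summits.FinalStateConjecture.FinalStateConjecture.Theorems.SwallowTheDatumKerrShieldedSettlesStubScriTransport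
import Literature.Geometry.Lorentzian.KerrRicciFlat
import Literature.Geometry.Lorentzian.KerrTimelikeSpan
import Literature.Geometry.Lorentzian.KerrSchildTimeTranslation
import Literature.Geometry.Lorentzian.KerrDataProofs
import Literature.Geometry.Lorentzian.KerrSchildCoord
import Literature.Geometry.Lorentzian.KerrWaveDecay

set_option linter.dupNamespace false

/-!
# Stub `stub_shieldedScri` of line `swallow-transfer`, crux `EIHFluxBalance.ModulatedKerrHandoff` (stmt-FinalStateConjecture-10167)

(Worker file; statement from the registered skeleton `Cruxes/ModulatedKerrHandoff/Lines/swallow_transfer.lean`,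
with the three `pullbackBilin (I := …) (I' := …)` named-argument applications spelled positionally as
`@pullbackBilin _ _ _ _ _ I _ _ _ _ _ _ _ _ I' _ _ _` — the stub registry cuts a signature at `:=`; the
proposition is unchanged: `example : <skeleton spelling> := stub_shieldedScri` elaborates by `exact`.)

Proof: pure composition of the landed stubs of crux 10054's line `tapered-temporal-collar` — unpack the
shield, rewrite the hard-coded height as `bentHeight M a` (`bentHeight_eq_literal`, `rfl`), unfold the two
pull-back identities pointwise, obtain the collar embedding `χ` from S3 `stub_collarEmbedsMGHD` (fed S1
`stub_collarCauchy`, S2 `Kerr.isRicciFlat_holds` and the route item `SubdataDevelopmentsEmbed`), and conclude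
by S5 `stub_scriTransport` fed S4 `stub_kerrLeafSojourn`.
-/

noncomputable section

open scoped Manifold ContDiff Topology ENNReal
open Filter Set TopologicalSpace Literature.Geometry.Lorentzian
open Summit.FinalStateConjecture.FinalStateConjecture.Theses.SwallowTheDatum
  (ParametricKerrBurial KerrShieldedSettles SubdataDevelopmentsEmbed MGHDExists)
open Summit.FinalStateConjecture.FinalStateConjecture.Theorems.KerrShieldedDataExist.Negative
  (bentHeight bentHeight_eq_literal)
open Summit.FinalStateConjecture.FinalStateConjecture.Theorems.SwallowTheDatum.KerrShieldedSettles
  (stub_collarCauchy stub_collarEmbedsMGHD stub_kerrLeafSojourn stub_scriTransport)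

namespace Summit.FinalStateConjecture.FinalStateConjecture.Cruxes.ModulatedKerrHandoff.SwallowTransfer

/-- **T1 `stub_shieldedScri`.** A Kerr-shielded admissible datum (the shield predicate is VERBATIM the hypothesis of
`SwallowTheDatum.KerrShieldedSettles`, item stmt-FinalStateConjecture-10054) has complete future null infinity in every
maximal vacuum Cauchy development. This is the first conjunct of `KerrShieldedSettles` (see
`shieldedScri_of_kerrShieldedSettles`); it is also what 10054's stubs S1–S5 (`tapered-temporal-collar`) and 9952's line
`scri-transfer-third-of-burial` prove. Li–Mei arXiv:2005.01249 §2.2; Dafermos–Rodnianski arXiv:0811.0354 §2.6.2. -/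
theorem stub_shieldedScri : SubdataDevelopmentsEmbed → ∀ [Kerr.Facts] (X : Type) [TopologicalSpace X]
    [ChartedSpace E3 X] [IsManifold (𝓡 3) ((⊤ : ℕ∞) : WithTop ℕ∞) X] [T2Space X] [SecondCountableTopology X]
    [ConnectedSpace X],
    ∀ D ∈ admissibleVacuumData X,
      (∃ (M a r₁ : ℝ) (hM : 0 ≤ M) (T : ℝ → ℝ) (φ : Literature.Geometry.Lorentzian.Kerr.slice a r₁ → X) (ψ : Literature.Geometry.Lorentzian.Kerr.slice a r₁ → Literature.Geometry.Lorentzian.Kerr.region a r₁) (ν : Literature.Geometry.Lorentzian.NormalField 𝓘(ℝ, Literature.Geometry.Lorentzian.E4) ψ), |a| < M ∧ Literature.Geometry.Lorentzian.Kerr.rMinus M a < r₁ ∧ r₁ < Literature.Geometry.Lorentzian.Kerr.rPlus M a ∧ T = (fun r : ℝ => Real.smoothTransition (r / (4 * M) - 1) * (((M) / Real.sqrt ((M) ^ 2 - (a) ^ 2)) * (Literature.Geometry.Lorentzian.Kerr.rPlus M a * Real.log (r - Literature.Geometry.Lorentzian.Kerr.rPlus M a) - Literature.Geometry.Lorentzian.Kerr.rMinus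 M a * Real.log (r - Literature.Geometry.Lorentzian.Kerr.rMinus M a)) - ((M) / Real.sqrt ((M) ^ 2 - (a) ^ 2)) * (Literature.Geometry.Lorentzian.Kerr.rPlus M a * Real.log ((4 * M) - Literature.Geometry.Lorentzian.Kerr.rPlus M a) - Literature.Geometry.Lorentzian.Kerr.rMinus M a * Real.log ((4 * M) - Literature.Geometry.Lorentzian.Kerr.rMinus M a)))) ∧ IsCompact (Set.range φ)ᶜ ∧ Topology.IsOpenEmbedding φ ∧ ContMDiff 𝓘(ℝ, Literature.Geometry.Lorentzian.E3) (𝓡 3) ((⊤ : ℕ∞) : WithTop ℕ∞) φ ∧ (∀ y : Literature.Geometry.Lorentzian.Kerr.slice a r₁, (ψ y : Literature.Geometry.Lorentzian.E4) = Literature.Geometry.Lorentzian.E4.ofTimeSpace (T (Literature.Geometry.Lorentzian.Kerr.radius a (Literature.Geometry.Lorentzian.E4.ofTimeSpace 0 (y : Literature.Geometry.Lorentzian.E3)))) (y : Literature.Geometry.Lorentzian.E3)) ∧ (Literature.Geometry.Lorentzian.Kerr.smoothMetric M a r₁).IsSpacelikeImmersion 𝓘(ℝ, Literature.Geometry.Lorentzian.E3)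 ψ ∧ (Literature.Geometry.Lorentzian.Kerr.smoothMetric M a r₁).IsFutureUnitNormal 𝓘(ℝ, Literature.Geometry.Lorentzian.E3) ((Literature.Geometry.Lorentzian.Kerr.timeOrientation M a r₁ hM).ofLE le_top) ψ ν ∧ (∀ y : Literature.Geometry.Lorentzian.Kerr.slice a r₁, @Literature.Geometry.Lorentzian.pullbackBilin _ _ _ _ _ (𝓡 3) _ _ _ _ _ _ _ _ 𝓘(ℝ, Literature.Geometry.Lorentzian.E3) _ _ _ φ (D).h.inner y = @Literature.Geometry.Lorentzian.pullbackBilin _ _ _ _ _ 𝓘(ℝ, Literature.Geometry.Lorentzian.E4) _ _ _ _ _ _ _ _ 𝓘(ℝ, Literature.Geometry.Lorentzian.E3) _ _ _ ψ (Literature.Geometry.Lorentzian.Kerr.smoothMetric M a r₁).val y) ∧ (∀ [(Literature.Geometry.Lorentzian.Kerr.smoothMetric M a r₁).HasLeviCivita] (y : Literature.Geometry.Lorentzian.Kerr.slice a r₁), (@Literature.Geometry.Lorentzian.pullbackBilin _ _ _ _ _ (𝓡 3) _ _ _ _ _ _ _ _ 𝓘(ℝ, Literature.Geometry.Lorentzian.E3)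 _ _ _ φ (D).k y).toLinearMap₁₂ = (Literature.Geometry.Lorentzian.Kerr.smoothMetric M a r₁).secondFundamentalForm 𝓘(ℝ, Literature.Geometry.Lorentzian.E3) ψ ν y)) →
      ∀ 𝒟 : VacuumCauchyDevelopment D, 𝒟.IsMaximal →
        Summit.FinalStateConjecture.HasCompleteNullInfinity 𝒟.toCauchyDevelopment := by
  intro hE _ X _ _ _ _ _ _ D hD hS 𝒟 h𝒟 _
  obtain ⟨M, a, r₁, hM, T, φ, ψ, ν, ha, hr₁, hr₂, hT, hK, hφo, hφs, hψ, hsp, hν, hh, hk⟩ := hS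
  have hT' : T = bentHeight M a := hT.trans (bentHeight_eq_literal M a).symm
  subst hT'
  -- the two pull-back identities, pointwise
  have hh' : ∀ (y : Kerr.slice a r₁) (v w : E3),
      D.h.inner (φ y) (mfderiv 𝓘(ℝ, E3) (𝓡 3) φ y v) (mfderiv 𝓘(ℝ, E3) (𝓡 3) φ y w) =
        Kerr.bilin M a (ψ y : E4) (mfderiv 𝓘(ℝ, E3) 𝓘(ℝ, E4) ψ y v)
          (mfderiv 𝓘(ℝ, E3) 𝓘(ℝ, E4) ψ y w) := fun y v w => by
    have h := congrArg (fun b => b v w) (hh y)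
    simp only [pullbackBilin_apply, Kerr.smoothMetric_val] at h
    convert h using 2 <;> rfl
  have hk' : ∀ [(Kerr.smoothMetric M a r₁).HasLeviCivita] (y : Kerr.slice a r₁) (v w : E3),
      D.k (φ y) (mfderiv 𝓘(ℝ, E3) (𝓡 3) φ y v) (mfderiv 𝓘(ℝ, E3) (𝓡 3) φ y w) =
        (Kerr.smoothMetric M a r₁).secondFundamentalForm 𝓘(ℝ, E3) ψ ν y v w := by
    intro _ y v w
    have h := congrArg (fun B => B v w) (hk y)
    simp only [ContinuousLinearMap.toLinearMap₁₂_apply, pullbackBilin_apply] at h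
    convert h using 2
  obtain ⟨χ, hχs, hχe, hχg, hχψ, hχν⟩ :=
    stub_collarEmbedsMGHD hE X D M a r₁ hM φ ψ ν ha hr₁ hr₂ hφo hφs hψ hsp hν hh' hk'
      (stub_collarCauchy M a r₁ hM ha hr₁ hr₂) (Kerr.isRicciFlat_holds M a r₁) 𝒟 h𝒟
  exact stub_scriTransport X D hD M a r₁ hM φ ψ ν ha hr₁ hr₂ hK hφo hφs hψ hh'
    (stub_kerrLeafSojourn M a r₁ hM ha hr₁ hr₂ ψ ν hψ hν) 𝒟 χ hχs hχe hχg hχψ hχν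


end Summit.FinalStateConjecture.FinalStateConjecture.Cruxes.ModulatedKerrHandoff.SwallowTransfer

end
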